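import Mathlib
import HarnessLib
import Literature.Analysis.FluidPDE.ClassicalSolution
import Literature.Analysis.FluidPDE.ClassicalSolutionRescale
import Literature.Analysis.FluidPDE.WholeSpaceIBP
import Literature.Analysis.FunctionSpaces.SobolevDomain
import Literature.Analysis.FunctionSpaces.TorusTestFunction

/-!
# Stub `stub_localL2Convergence` of the line `Sketch` (crux stmt-AnomalousDissipation-19035,
# `PointSink.SolitonTransplant`): integer-shell `L²` convergence upgrades to every fixed annulus

Registered signature (proved here, textually; `E³ = EuclideanSpace ℝ (Fin 3)`, `𝕋³ = UnitAddTorus (Fin 3)`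
are the skeleton's local notations, redeclared below):
```
theorem stub_localL2Convergence :
    ∀ (Q V : E³ → E³) (lam : ℝ), 1 < lam → Continuous Q →
      AEStronglyMeasurable V volume →
      LocallyIntegrableOn (fun x => ‖V x‖ ^ 2) {x : E³ | x ≠ 0} volume →
      (∀ a : ℤ, Tendsto (fun k : ℕ =>
        ∫ x in {x : E³ | lam ^ a < ‖x‖ ∧ ‖x‖ < lam ^ (a + 1)},
          ‖(lam ^ k) ^ (2 / 3 : ℝ) • Q (lam ^ k • x) - V x‖ ^ 2) atTop (𝓝 0)) →
      ∀ a b : ℝ, 0 < a → a < b → Tendsto (fun k : ℕ =>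
        ∫ x in {x : E³ | a < ‖x‖ ∧ ‖x‖ < b},
          ‖(lam ^ k) ^ (2 / 3 : ℝ) • Q (lam ^ k • x) - V x‖ ^ 2) atTop (𝓝 0)
```
Proof (pure measure theory).  Write `g_k = |(λᵏ)^{2/3} Q(λᵏ·) − V|² ≥ 0`.  Choose `m : ℕ` with
`λ^{-m} < a` and `b < λ^m` (`pow_unbounded_of_one_lt`); every `x` with `a < |x| < b` satisfies
`λⁿ ≤ |x| < λⁿ⁺¹` for some `n ∈ [-m, m)` (`exists_mem_Ico_zpow` + strict monotonicity of `n ↦ λⁿ`),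
so the annulus is contained in the finite disjoint union of the open shells `{λⁿ < |x| < λⁿ⁺¹}`,
`-m ≤ n < m`, up to the Lebesgue-null union of the spheres `{|x| = λⁿ}` (`Measure.addHaar_sphere`).
Each `g_k` is integrable on every shell (the closed shell is compact and avoids `0`, `|V|²` is
integrable there by local integrability, the rescaled `Q` is continuous hence bounded, and
`|u − v|² ≤ 2|u|² + 2|v|²`), hence `0 ≤ ∫_{a<|x|<b} g_k ≤ Σ_{-m ≤ n < m} ∫_{shellₙ} g_k → 0`
(`setIntegral_mono_set`, `integral_biUnion_finset`, `tendsto_finsetSum`, `squeeze_zero`).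
Pure proof file (no definitions). [folklore]
-/

-- `Summit.<Summit>.<Problem>` is the tree's mandated summit-side namespace (CONVENTIONS §2); for this
-- single-conjunct summit the two coincide, so the duplicate is deliberate.
set_option linter.dupNamespace false

noncomputable section

namespace Summit.AnomalousDissipation.AnomalousDissipation.Theorems

open MeasureTheory Filter Topology Set Metric
open scoped InnerProductSpace ContDiff Laplacian
open Literature.Analysis.FunctionSpaces Literature.Analysis.FluidPDE

/-- Physical space `ℝ³` (local notation, as in the registered skeleton). -/
local notation "E³" => EuclideanSpace ℝ (Fin 3)
/-- The flat three-torus (local notation, as in the registered skeleton). -/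
local notation "𝕋³" => UnitAddTorus (Fin 3)

/-! ### Abstract squeeze over a finite almost-everywhere cover -/

/-- **Abstract squeeze.** If `A` is a.e.-contained in a finite disjoint union of measurable pieces
`S n`, `n ∈ I`, and the nonnegative densities `F k` are integrable on each piece with
`∫_{S n} F k → 0` for every `n ∈ I`, then `∫_A F k → 0`. [folklore] -/
private theorem tendsto_setIntegral_of_ae_cover {α : Type*} [MeasurableSpace α] {μ : Measure α}
    {ι : Type*} (I : Finset ι) (S : ι → Set α) (A : Set α) (F : ℕ → α → ℝ)
    (hS : ∀ n ∈ I, MeasurableSet (S n)) (hdisj : Set.Pairwise (↑I) (Function.onFun Disjoint S))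
    (hA : A ≤ᵐ[μ] ⋃ n ∈ I, S n) (hF0 : ∀ k x, 0 ≤ F k x)
    (hFi : ∀ k, ∀ n ∈ I, IntegrableOn (F k) (S n) μ)
    (hlim : ∀ n ∈ I, Tendsto (fun k => ∫ x in S n, F k x ∂μ) atTop (𝓝 0)) :
    Tendsto (fun k => ∫ x in A, F k x ∂μ) atTop (𝓝 0) := by
  have hbound : ∀ k, ∫ x in A, F k x ∂μ ≤ ∑ n ∈ I, ∫ x in S n, F k x ∂μ := fun k => by
    rw [← integral_biUnion_finset I hS hdisj (hFi k)]
    exact setIntegral_mono_set (integrableOn_finset_iUnion.mpr (hFi k))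
      (Eventually.of_forall fun x => hF0 k x) hA
  refine squeeze_zero (fun k => ?_) hbound ?_
  · exact integral_nonneg (hF0 k)
  · simpa using tendsto_finsetSum I hlim

/-! ### Dyadic shells of `ℝ³`: measurability, disjointness, the null spheres, the cover -/

/-- The open dyadic shell `{λⁿ < |x| < λⁿ⁺¹}` is (open, hence) measurable. [folklore] -/
private theorem measurableSet_shell (lam : ℝ) (n : ℤ) :
    MeasurableSet {x : E³ | lam ^ n < ‖x‖ ∧ ‖x‖ < lam ^ (n + 1)} :=
  ((isOpen_lt continuous_const continuous_norm).inter
    (isOpen_lt continuous_norm continuous_const)).measurableSet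

/-- Distinct dyadic shells `{λⁱ < |x| < λⁱ⁺¹}`, `{λʲ < |x| < λʲ⁺¹}` (`i ≠ j`, `1 < λ`) are disjoint,
by monotonicity of `n ↦ λⁿ`. [folklore] -/
private theorem pairwise_disjoint_shell {lam : ℝ} (hlam : 1 < lam) :
    Pairwise (Function.onFun Disjoint fun n : ℤ => {x : E³ | lam ^ n < ‖x‖ ∧ ‖x‖ < lam ^ (n + 1)}) := by
  refine (pairwise_disjoint_on _).mpr fun i j hij => Set.disjoint_left.mpr fun x hxi hxj => ?_
  have h1 : lam ^ (i + 1) ≤ lam ^ j := zpow_le_zpow_right₀ hlam.le (by omega)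
  exact lt_irrefl _ ((hxi.2.trans_le h1).trans hxj.1)

/-- The spheres `{|x| = λⁿ}`, `n ∈ ℤ`, form a Lebesgue-null subset of `ℝ³` (`λ ≠ 0`). [folklore] -/
private theorem volume_iUnion_sphere_zpow {lam : ℝ} (hlam : 1 < lam) :
    volume (⋃ n : ℤ, Metric.sphere (0 : E³) (lam ^ n)) = 0 :=
  measure_iUnion_null fun n =>
    Measure.addHaar_sphere_of_ne_zero volume (0 : E³) (zpow_ne_zero n (by positivity))

/-- **Cover.** For `1 < λ` and `0 < a` there is `m : ℕ` such that every point of the annulus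
`{a < |x| < b}` outside the open shells `{λⁿ < |x| < λⁿ⁺¹}`, `-m ≤ n < m`, lies on one of the
spheres `{|x| = λⁿ}`, `n ∈ ℤ`. [folklore] -/
private theorem annulus_diff_shells_subset {lam a b : ℝ} (hlam : 1 < lam) (ha : 0 < a) :
    ∃ m : ℕ, {x : E³ | a < ‖x‖ ∧ ‖x‖ < b} \
        (⋃ n ∈ Finset.Ico (-(m : ℤ)) m, {x : E³ | lam ^ n < ‖x‖ ∧ ‖x‖ < lam ^ (n + 1)}) ⊆
      ⋃ n : ℤ, Metric.sphere (0 : E³) (lam ^ n) := by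
  obtain ⟨m, hm⟩ := pow_unbounded_of_one_lt (max b a⁻¹) hlam
  refine ⟨m, fun x hx => ?_⟩
  obtain ⟨⟨hax, hxb⟩, hxU⟩ := hx
  obtain ⟨n, hn, hn'⟩ := exists_mem_Ico_zpow (ha.trans hax) hlam
  have hm₁ : b < lam ^ (m : ℤ) := by
    rw [zpow_natCast]
    exact (le_max_left _ _).trans_lt hm
  have hm₂ : lam ^ (-(m : ℤ)) < a := by
    rw [zpow_neg, zpow_natCast]
    exact inv_lt_of_inv_lt₀ ha ((le_max_right _ _).trans_lt hm)
  have h1 : n < m := (zpow_lt_zpow_iff_right₀ hlam).mp (hn.trans_lt (hxb.trans hm₁))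
  have h2 : -(m : ℤ) < n + 1 := (zpow_lt_zpow_iff_right₀ hlam).mp (hm₂.trans (hax.trans hn'))
  rcases hn.eq_or_lt with heq | hlt
  · exact Set.mem_iUnion.mpr ⟨n, mem_sphere_zero_iff_norm.mpr heq.symm⟩
  · exact (hxU (Set.mem_iUnion₂.mpr ⟨n, Finset.mem_Ico.mpr ⟨by omega, h1⟩, hlt, hn'⟩)).elim

/-! ### Integrability of the defect density on shells -/

/-- `|u − v|² ≤ 2|u|² + 2|v|²`. [folklore] -/
private theorem norm_sub_sq_le_two_mul (u v : E³) : ‖u - v‖ ^ 2 ≤ 2 * ‖u‖ ^ 2 + 2 * ‖v‖ ^ 2 := by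
  have h1 : ‖u - v‖ ^ 2 ≤ (‖u‖ + ‖v‖) ^ 2 := pow_le_pow_left₀ (norm_nonneg _) (norm_sub_le u v) 2
  nlinarith [sq_nonneg (‖u‖ - ‖v‖)]

/-- On a compact `K ⊆ ℝ³ ∖ {0}` the density `|Q' − V|²` is integrable, for `Q'` continuous, `V`
a.e.-strongly measurable with `|V|² ∈ L¹_loc(ℝ³ ∖ {0})`: it is a.e.-strongly measurable and dominated
by the integrable `2|Q'|² + 2|V|²`. [folklore] -/
private theorem integrableOn_normSq_sub {Q' V : E³ → E³} {K : Set E³} (hQ' : Continuous Q')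
    (hV : AEStronglyMeasurable V volume)
    (hVloc : LocallyIntegrableOn (fun x => ‖V x‖ ^ 2) {x : E³ | x ≠ 0} volume)
    (hK : IsCompact K) (hK0 : K ⊆ {x : E³ | x ≠ 0}) :
    IntegrableOn (fun x => ‖Q' x - V x‖ ^ 2) K volume := by
  have hVK : IntegrableOn (fun x => ‖V x‖ ^ 2) K volume := hVloc.integrableOn_compact_subset hK0 hK
  have hQK : IntegrableOn (fun x => ‖Q' x‖ ^ 2) K volume :=
    (hQ'.norm.pow 2).continuousOn.integrableOn_compact hK
  have hmeas : AEStronglyMeasurable (fun x => ‖Q' x - V x‖ ^ 2) (volume.restrict K) :=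
    ((continuous_norm.pow 2).comp_aestronglyMeasurable (hQ'.aestronglyMeasurable.sub hV)).restrict
  have hg : Integrable (fun x => 2 * ‖Q' x‖ ^ 2 + 2 * ‖V x‖ ^ 2) (volume.restrict K) :=
    (hQK.const_mul 2).add (hVK.const_mul 2)
  refine hg.mono' hmeas (Eventually.of_forall fun x => ?_)
  rw [Real.norm_of_nonneg (sq_nonneg _)]
  exact norm_sub_sq_le_two_mul (Q' x) (V x)

/-- The density `|Q' − V|²` of `integrableOn_normSq_sub` is integrable on every open dyadic shell
`{λⁿ < |x| < λⁿ⁺¹}` (`0 < λ`): the shell lies in the compact `closedBall 0 λⁿ⁺¹ ∖ ball 0 λⁿ ⊆ ℝ³ ∖ {0}`.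
[folklore] -/
private theorem integrableOn_normSq_sub_shell {Q' V : E³ → E³} (hQ' : Continuous Q')
    (hV : AEStronglyMeasurable V volume)
    (hVloc : LocallyIntegrableOn (fun x => ‖V x‖ ^ 2) {x : E³ | x ≠ 0} volume)
    {lam : ℝ} (hlam : 0 < lam) (n : ℤ) :
    IntegrableOn (fun x => ‖Q' x - V x‖ ^ 2)
      {x : E³ | lam ^ n < ‖x‖ ∧ ‖x‖ < lam ^ (n + 1)} volume := by
  refine (integrableOn_normSq_sub hQ' hV hVloc
    ((isCompact_closedBall (0 : E³) (lam ^ (n + 1))).diff isOpen_ball) fun x hx => ?_).mono_set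
    fun x hx => ⟨mem_closedBall_zero_iff.mpr hx.2.le, fun h => lt_asymm hx.1 (mem_ball_zero_iff.mp h)⟩
  have hle : lam ^ n ≤ ‖x‖ := not_lt.mp fun h => hx.2 (mem_ball_zero_iff.mpr h)
  exact norm_pos_iff.mp ((zpow_pos hlam n).trans_le hle)

/-! ### The registered stub -/

/-- **S2 `stub_localL2Convergence`.** Integer-shell convergence of the rescalings
`Q_k = (λ^k)^{2/3}Q(λ^k ·)` to `V` upgrades to `L²` convergence on every fixed annulus `a < |x| < b`
(`0 < a < b`): cover the annulus, up to the Lebesgue-null spheres `|x| = λⁿ`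
(`Measure.addHaar_sphere_of_ne_zero`), by the finitely many disjoint open shells `λⁿ < |x| < λⁿ⁺¹`,
`-m ≤ n < m`, and squeeze (the integrand is nonnegative and integrable on each shell: `Q` continuous,
`V` a.e.-strongly measurable with `|V|² ∈ L¹_loc(ℝ³∖0)`). [folklore] -/
theorem stub_localL2Convergence :
    ∀ (Q V : E³ → E³) (lam : ℝ), 1 < lam → Continuous Q →
      AEStronglyMeasurable V volume →
      LocallyIntegrableOn (fun x => ‖V x‖ ^ 2) {x : E³ | x ≠ 0} volume →
      (∀ a : ℤ, Tendsto (fun k : ℕ =>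
        ∫ x in {x : E³ | lam ^ a < ‖x‖ ∧ ‖x‖ < lam ^ (a + 1)},
          ‖(lam ^ k) ^ (2 / 3 : ℝ) • Q (lam ^ k • x) - V x‖ ^ 2) atTop (𝓝 0)) →
      ∀ a b : ℝ, 0 < a → a < b → Tendsto (fun k : ℕ =>
        ∫ x in {x : E³ | a < ‖x‖ ∧ ‖x‖ < b},
          ‖(lam ^ k) ^ (2 / 3 : ℝ) • Q (lam ^ k • x) - V x‖ ^ 2) atTop (𝓝 0) := by
  intro Q V lam hlam hQ hV hVloc hshell a b ha _hab
  obtain ⟨m, hm⟩ := annulus_diff_shells_subset (b := b) hlam ha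
  refine tendsto_setIntegral_of_ae_cover (μ := volume) (Finset.Ico (-(m : ℤ)) m)
    (fun n : ℤ => {x : E³ | lam ^ n < ‖x‖ ∧ ‖x‖ < lam ^ (n + 1)}) {x : E³ | a < ‖x‖ ∧ ‖x‖ < b}
    (fun (k : ℕ) (x : E³) => ‖(lam ^ k) ^ (2 / 3 : ℝ) • Q (lam ^ k • x) - V x‖ ^ 2)
    (fun n _ => measurableSet_shell lam n) ((pairwise_disjoint_shell hlam).set_pairwise _)
    (ae_le_set.mpr (measure_mono_null hm (volume_iUnion_sphere_zpow hlam)))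
    (fun k x => sq_nonneg _) (fun k n _ => ?_) (fun n _ => hshell n)
  have hQk : Continuous fun x : E³ => (lam ^ k) ^ (2 / 3 : ℝ) • Q (lam ^ k • x) := by fun_prop
  exact integrableOn_normSq_sub_shell hQk hV hVloc (zero_lt_one.trans hlam) n

end Summit.AnomalousDissipation.AnomalousDissipation.Theorems

end
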